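import Summits.BirchSwinnertonDyer.BirchSwinnertonDyer.Theorems.ByReductionTypeAtTwoSupersingularFlatReciprocityConstant
import Summits.BirchSwinnertonDyer.BirchSwinnertonDyer.Theorems.ByReductionTypeAtTwoSupersingularFlatZetaF3AssemblyPowTwo
import HarnessLib

/-!
# Crux `SupersingularRankZeroAtTwo` (K4, item stmt-BirchSwinnertonDyer-19097), line `odd_blind_package` v2.20, `stub_flatPackage`
# conjunct (8), F3b — FILE B1c of hand «(B1)♭-DECIDE»: THE ♭-PRIMITIVITY DOOR — the F3 assembly with its `2`-adic conditions
# `h2 ∧ (t, ht)` REPLACED by the normalisation-free pair «some class of the family is ♭-primitive» ∧ «`v₂(ϖ) ≥ 0`»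

Seat `bsd-2adic-tower-1` GEN 70 (pen GEN 41 SUMMON 20260831T234826Z; LEAD ss-1 GEN 26 CORRECTION + v2.21 SHAPE (2) 2026-09-01T00:06Z:
«h2♭′ = ♭-primitivity of Kato's zeta line at (2) … stated ON a print-witnessed family (U∃) or in tower-1's rescaling-invariant currency
(U-inv)»). HONEST FRAMING: theorems only (no definition, no named fact, no instance, no `sorry`); helper toward the displayed residue of
conjunct (8) F3b of `stub_flatPackage`; closes no stub and no item; 19097 OPEN; BSD₂ is proved for no supersingular curve and BSD for no curve.

## What

Z6 (`SSFlatPackage.flatF3_package_of_levelCongruences`) needs its family `(x_δ, A_δ, d)` NORMALISED: `h2` («some `A_δ ∉ (2)`») and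
`t = ϖ·d ∈ ℤ₂`.  The capstone's family comes in the E5 normalisation `A_δ = C(N·q.num)·μ̃_δ`, `d = D·q.den`, whose `2`-content depends on the
∃-choices `q` (Kato's constant of the displayed family) and `D` (the cusp brick's denominator) — not invariants of the curve.  This file removes
the normalisation:
* §1 ★ `C_mul_coleman_eq_mul_of_family'` — the ♭/♯ ERL of the family `C d · (J (L x_δ)).2 = A_δ · L♭` with coprimality ONLY at the
  height-one primes `∌ p` (Z7's slack generator `exists_pow_smul_eq_coleman_of_family`, then cancel `C(p^k)` in the domain `Λ`).
* §2 rescaling algebra: `hE3` is homogeneous (`levelCongruence_of_C_pow_mul`), coprimality off `p` descends to `A_δ / p^e`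
  (`not_mem_of_C_pow_mul_not_mem`).
* §3 ★★★ `flatF3_package_of_levelCongruences_of_flatPrimitive` (the habitat, `p = 2`): Z6's binders with `h2`, `t`, `ht` DELETED and
  `(hprim : ∃ δ, (J (L (x δ))).2 ∉ Ideal.span {C 2})`, `(hϖ : 0 ≤ padicValRat 2 ϖ)` ADDED; `(A, d)` in ANY normalisation; conclusion
  F3a ∧ F3b ∧ ZL2 VERBATIM.  Proof: take `e` maximal with `C(2^e) ∣ A_δ` for all `δ` and `2^e ∣ d`; the rescaled family `(A/2^e, d/2^e)`
  satisfies `h2` — if every `A_δ/2^e ∈ (2)` then either `2 ∣ d/2^e` (contradicting maximality) or `d/2^e` is a unit and the ERL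
  `C(d/2^e)·Col♭(L x_δ) = (A_δ/2^e)·L♭` puts every `Col♭(L x_δ)` in `(2)` (contradicting `hprim`) — and Z6 applies to it with `t := ϖ·(d/2^e)`.
  No `μ(L♭) = 0` hypothesis is needed.

References: [Kato2004Asterisque] Thm. 12.4 (2)(3), Thm. 12.5 (1)(4), Thm. 12.6, §13.9, §13.12–13.14 (pp. 221–234); [Sprung2017] Thm. 1.12,
Cor. 4.4–4.5; [Sprung2012] Def. 7.1, Thm. 7.14, 7.16; [Washington1997] §13.1–13.2.
-/

set_option autoImplicit false
-- the Theorems namespace of this sub repeats the summit name by design (D-0017 nested layout)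
set_option linter.dupNamespace false

noncomputable section

open scoped Classical NumberField

open Polynomial

namespace Summit.BirchSwinnertonDyer.BirchSwinnertonDyer.Theorems

namespace SSFlatERL

open NumberField IsDedekindDomain WeierstrassCurve Literature.NumberTheory.EllipticCurves
  Literature.NumberTheory.EllipticCurves.ZpExtension Literature.NumberTheory.EllipticCurves.Sprung2017
  Literature.NumberTheory.EllipticCurves.Kobayashi2003 Literature.NumberTheory.EllipticCurves.Sprung2012
  Literature.NumberTheory.EllipticCurves.Rank1Residual Literature.NumberTheory.GaloisRepresentations CongruenceSubgroup
  SSFlatPackage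
open Literature.NumberTheory.EllipticCurves.IwasawaAlgebra

/-! ## §1 The ♭ explicit reciprocity law of the family WITHOUT coprimality at `(p)` -/

section Family

universe u

variable {K : Type u} [Field K] {p : ℕ} [hp : Fact p.Prime] {κ : ZpExtension K p}
variable {E : Type u} [Field E] [Algebra K E] {ι' : AlgebraicClosure K →ₐ[K] AlgebraicClosure E}
variable {W : WeierstrassCurve K}

/-- ★ **THE ♭/♯ ERL OF THE FAMILY, coprimality only OFF `p`.**  In the frame of Z7's `exists_pow_smul_eq_coleman_of_family` (multipliers
`A_δ` coprime at the height-one primes `∌ p`, `d ≠ 0`, levelwise congruences, a Sprung pair `(L♯, L♭)`): `C d · (J (L x_δ)).2 = A_δ · L♭` and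
`C d · (J (L x_δ)).1 = A_δ · L♯` for every `δ` — from `A_δ • σ₀ = C(p)^k • J (L x_δ)`, `C d·σ₀ = C(p)^k·(L♯, L♭)`, cancelling `C(p)^k`.
[cite: Kato2004Asterisque, Thm. 12.5 (1)(4), Thm. 12.6 (p. 222), §13.9 (p. 230)] [cite: Sprung2017, Thm. 1.12, Cor. 4.4–4.5] -/
theorem C_mul_coleman_eq_mul_of_family' {g : Field.absoluteGaloisGroup E}
    (hg : κ.IsTopGenerator (resGalOfEmb ι' g)) {ap : ℤ} (hap : (p : ℤ) ∣ ap) {c : ℕ → localPoints W E}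
    {H : Type*} [AddCommGroup H] [Module (IwasawaAlgebra p) H]
    (L : letI := moduleOfGenerator κ ι' W hg; H →ₗ[IwasawaAlgebra p] (localTowerPointsOfEmb κ ι' W →+ ℤ_[p]))
    (J : letI := moduleOfGenerator κ ι' W hg
      (localTowerPointsOfEmb κ ι' W →+ ℤ_[p]) →ₗ[IwasawaAlgebra p] IwasawaAlgebra p × IwasawaAlgebra p)
    (hJ : ∀ w, IsColemanPair κ ι' W ap g c w (J w).1 (J w).2)
    {ι : Type*} (x : ι → H) (A : ι → IwasawaAlgebra p) {d : ℤ_[p]} (hd : d ≠ 0)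
    (hcop : ∀ 𝔭 : PrimeSpectrum (IwasawaAlgebra p), 𝔭.asIdeal.height = 1 →
      PowerSeries.C (p : ℤ_[p]) ∉ 𝔭.asIdeal → ∃ i, A i ∉ 𝔭.asIdeal)
    {N : ℕ} (f : CuspForm (Gamma0 N) 2) {Ls Lf : IwasawaAlgebra p} (hL : IsSprungPair f p ap Ls Lf)
    (hE3 : ∀ (i : ι) (n : ℕ), ∃ (m : ℕ) (q : IwasawaAlgebra p), PowerSeries.C ((p : ℚ_[p]) ^ m) *
        (iwasawaToPowerSeries p (A i) * (((mazurTateElement f p n).map (algebraMap ℚ ℚ_[p]) : ℚ_[p][X]) : PowerSeries ℚ_[p]) -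
          iwasawaToPowerSeries p (PowerSeries.C d * pairingSum W (localTowerPointsOfEmb κ ι' W) g n (c n) (L (x i)))) =
      iwasawaToPowerSeries p ((((cyclotomicOmega p n).map (Int.castRingHom ℤ_[p]) : ℤ_[p][X]) : PowerSeries ℤ_[p]) * q)) (i : ι) :
    PowerSeries.C d * (J (L (x i))).2 = A i * Lf ∧ PowerSeries.C d * (J (L (x i))).1 = A i * Ls := by
  letI := moduleOfGenerator κ ι' W hg
  obtain ⟨σ₀, k, hσ₀, hs, hf⟩ := exists_pow_smul_eq_coleman_of_family hg hap L J hJ x A hd hcop f hL hE3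
  have hPk : (PowerSeries.C (p : ℤ_[p]) : IwasawaAlgebra p) ^ k ≠ 0 :=
    pow_ne_zero _ (fun h ↦ hp.out.ne_zero (by
      have := congrArg (PowerSeries.constantCoeff (R := ℤ_[p])) h
      simp only [PowerSeries.constantCoeff_C, map_zero] at this
      exact_mod_cast this))
  have h2 := congrArg Prod.snd (hσ₀ i)
  have h1 := congrArg Prod.fst (hσ₀ i)
  simp only [Prod.smul_snd, Prod.smul_fst, smul_eq_mul] at h1 h2
  constructor
  · apply mul_left_cancel₀ hPk
    calc (PowerSeries.C (p : ℤ_[p]) : IwasawaAlgebra p) ^ k * (PowerSeries.C d * (J (L (x i))).2)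
        = PowerSeries.C d * ((PowerSeries.C (p : ℤ_[p])) ^ k * (J (L (x i))).2) := by ring
      _ = PowerSeries.C d * (A i * σ₀.2) := by rw [h2]
      _ = A i * (PowerSeries.C d * σ₀.2) := by ring
      _ = (PowerSeries.C (p : ℤ_[p])) ^ k * (A i * Lf) := by rw [hf]; ring
  · apply mul_left_cancel₀ hPk
    calc (PowerSeries.C (p : ℤ_[p]) : IwasawaAlgebra p) ^ k * (PowerSeries.C d * (J (L (x i))).1)
        = PowerSeries.C d * ((PowerSeries.C (p : ℤ_[p])) ^ k * (J (L (x i))).1) := by ring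
      _ = PowerSeries.C d * (A i * σ₀.1) := by rw [h1]
      _ = A i * (PowerSeries.C d * σ₀.1) := by ring
      _ = (PowerSeries.C (p : ℤ_[p])) ^ k * (A i * Ls) := by rw [hs]; ring

end Family

/-! ## §2 Rescaling algebra -/

section Rescale

variable {p : ℕ} [hp : Fact p.Prime]

/-- **Homogeneity of the levelwise congruence.**  If `A = C(p^e)·A'` and `d = p^e·d'`, the E3 congruence for `(A, d)` (slack `p^m`)
gives the E3 congruence for `(A', d')` (slack `p^{m+e}`), for any `Θ ∈ ℚ_p⟦T⟧` and any pairing sum `P ∈ Λ`.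
[cite: Kato2004Asterisque, §13.9 (p. 230)] [cite: Pollack2003, Prop. 6.18 (shape)] -/
theorem levelCongruence_of_C_pow_mul (e : ℕ) {A A' : IwasawaAlgebra p} (hA : A = PowerSeries.C ((p : ℤ_[p]) ^ e) * A')
    {d d' : ℤ_[p]} (hd : d = (p : ℤ_[p]) ^ e * d') (Θ : PowerSeries ℚ_[p]) (P Ω : IwasawaAlgebra p)
    (h : ∃ (m : ℕ) (q : IwasawaAlgebra p), PowerSeries.C ((p : ℚ_[p]) ^ m) *
        (iwasawaToPowerSeries p A * Θ - iwasawaToPowerSeries p (PowerSeries.C d * P)) = iwasawaToPowerSeries p (Ω * q)) :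
    ∃ (m : ℕ) (q : IwasawaAlgebra p), PowerSeries.C ((p : ℚ_[p]) ^ m) *
        (iwasawaToPowerSeries p A' * Θ - iwasawaToPowerSeries p (PowerSeries.C d' * P)) = iwasawaToPowerSeries p (Ω * q) := by
  obtain ⟨m, q, hq⟩ := h
  refine ⟨m + e, q, ?_⟩
  have hCe : iwasawaToPowerSeries p (PowerSeries.C ((p : ℤ_[p]) ^ e)) = PowerSeries.C ((p : ℚ_[p]) ^ e) :=
    iwasawaToPowerSeries_C_natCast_pow (p := p) e
  have hCd : (PowerSeries.C d : IwasawaAlgebra p) = PowerSeries.C ((p : ℤ_[p]) ^ e) * PowerSeries.C d' := by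
    rw [hd, map_mul]
  rw [hA, hCd, map_mul, hCe, mul_assoc (PowerSeries.C ((p : ℤ_[p]) ^ e)), map_mul, hCe] at hq
  rw [← hq, pow_add, map_mul]
  ring

/-- If `A = C(p^e)·A'` and `A ∉ 𝔭` then `A' ∉ 𝔭` (ideal). [folklore] -/
theorem not_mem_of_C_pow_mul_not_mem {e : ℕ} {A A' : IwasawaAlgebra p} (hA : A = PowerSeries.C ((p : ℤ_[p]) ^ e) * A')
    {𝔭 : Ideal (IwasawaAlgebra p)} (h : A ∉ 𝔭) : A' ∉ 𝔭 :=
  fun h' ↦ h (hA ▸ Ideal.mul_mem_left _ _ h')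

/-- `p^e ∣ d ≠ 0` in `ℤ_p` forces `e ≤ v_p(d)`. [folklore] -/
theorem le_valuation_of_pow_dvd {d : ℤ_[p]} (hd : d ≠ 0) {e : ℕ} (h : (p : ℤ_[p]) ^ e ∣ d) : e ≤ d.valuation :=
  (PadicInt.mem_span_pow_iff_le_valuation d hd e).mp (Ideal.mem_span_singleton.mpr h)

/-- A non-zero `p`-adic integer not divisible by `p` is a unit. [folklore] -/
theorem isUnit_padicInt_of_not_dvd {d : ℤ_[p]} (h : ¬ (p : ℤ_[p]) ∣ d) : IsUnit d := by
  rw [PadicInt.isUnit_iff]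
  by_contra h1
  exact h ((PadicInt.norm_lt_one_iff_dvd d).mp (lt_of_le_of_ne d.norm_le_one h1))

end Rescale

/-! ## §3 The habitat (`p = 2`): F3a ∧ F3b ∧ ZL2 from ♭-PRIMITIVITY and `v₂(ϖ) ≥ 0`, in ANY normalisation -/

section Habitat

variable (W : WeierstrassCurve ℚ) [W.IsElliptic] [W.IsGloballyMinimal] [ContinuousSMul ℤ_[2] (W.tateModule 2)]
  [Module.Free ℤ_[2] (W.tateModule 2)] [Module.Finite ℤ_[2] (W.tateModule 2)]
  {κ : ZpExtension ℚ 2} {γ : Field.absoluteGaloisGroup ℚ} (v : HeightOneSpectrum (𝓞 ℚ))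
  {g : Field.absoluteGaloisGroup (v.adicCompletion ℚ)} {c : ℕ → localPoints W (v.adicCompletion ℚ)}

/-- ★★★ **F3a ∧ F3b ∧ ZL2 OF CONJUNCT (8) FROM A ♭-PRIMITIVE FAMILY, ANY NORMALISATION.**  The assembly
`SSFlatPackage.flatF3_package_of_levelCongruences` (Z6) with its three normalisation-dependent binders `h2`, `t`, `ht` DELETED and replaced
by `hprim : ∃ δ, (J (L (x δ))).2 ∉ Ideal.span {C 2}` («some class of the displayed family has ♭-Coleman image not divisible by `2`» —
♭-PRIMITIVITY of Kato's zeta line at `(2)`, a statement about the classes, invariant under `(A, d) ↦ (2^j A, 2^j d)`) and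
`hϖ : 0 ≤ padicValRat 2 ϖ` («`ϖ = Ω⁺_f/Ω_W` is `2`-integral» — on the habitat a corollary of Abbes–Ullmo via the tree's
`realPeriodRat_eq_unit_mul_plusPeriod_two_of_abbesUllmo`).  Same conclusion as Z6, token for token.  Proof: rescale `(A, d)` by the
maximal `2^e` dividing all of them (§2), show `h2` for the rescaled family from `hprim` and the ERL of §1, apply Z6 with `t := ϖ·(d/2^e)`.
[cite: Kato2004Asterisque, Thm. 12.4 (2)(3) (p. 221), Thm. 12.5 (1)(4), Thm. 12.6 (p. 222), §13.9, §13.12–13.14 (pp. 230–234)]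
[cite: Sprung2012, Def. 7.1 (p. 1500), Thm. 7.14, 7.16] [cite: Sprung2017, Thm. 1.12, Cor. 4.4–4.5] -/
theorem flatF3_package_of_levelCongruences_of_flatPrimitive (hss : GoodSS W 2) (hκ : κ.IsCyclotomic)
    (hγ : κ.IsTopGenerator γ)
    (hg : κ.IsTopGenerator (resGalOfEmb (closureEmb (K := ℚ) (v.adicCompletion ℚ)) g)) {ap : ℤ} (hap : (2 : ℤ) ∣ ap)
    (I : Kato2004.IwasawaH1Data W 2 κ γ) (hrank : Module.rank (IwasawaAlgebra 2) I.H ≤ 1)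
    (L : letI := moduleOfGenerator κ (closureEmb (K := ℚ) (v.adicCompletion ℚ)) W hg
      I.H →ₗ[IwasawaAlgebra 2] (localTowerPointsOfEmb κ (closureEmb (K := ℚ) (v.adicCompletion ℚ)) W →+ ℤ_[2]))
    (J : letI := moduleOfGenerator κ (closureEmb (K := ℚ) (v.adicCompletion ℚ)) W hg
      (localTowerPointsOfEmb κ (closureEmb (K := ℚ) (v.adicCompletion ℚ)) W →+ ℤ_[2]) →ₗ[IwasawaAlgebra 2]
        IwasawaAlgebra 2 × IwasawaAlgebra 2)
    (hJ : ∀ w, IsColemanPair κ (closureEmb (K := ℚ) (v.adicCompletion ℚ)) W ap g c w (J w).1 (J w).2)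
    (P : Submodule (IwasawaAlgebra 2) (IwasawaAlgebra 2)) (loc : I.H →ₗ[IwasawaAlgebra 2] P)
    (hloc : ∀ x : I.H, (loc x : IwasawaAlgebra 2) = (J (L x)).2)
    {N : ℕ} (f : CuspForm (Gamma0 N) 2) (ϖ : ℚ) (Ls Lf : IwasawaAlgebra 2) (hL : IsSprungPair f 2 ap Ls Lf) (hLf : Lf ≠ 0)
    {ι : Type*} (x : ι → I.H) (A : ι → IwasawaAlgebra 2) {d : ℤ_[2]} (hd : d ≠ 0)
    (hE3 : ∀ (i : ι) (n : ℕ), ∃ (m : ℕ) (q : IwasawaAlgebra 2), PowerSeries.C ((2 : ℚ_[2]) ^ m) *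
        (iwasawaToPowerSeries 2 (A i) * (((mazurTateElement f 2 n).map (algebraMap ℚ ℚ_[2]) : ℚ_[2][X]) : PowerSeries ℚ_[2]) -
          iwasawaToPowerSeries 2 (PowerSeries.C d *
            pairingSum W (localTowerPointsOfEmb κ (closureEmb (K := ℚ) (v.adicCompletion ℚ)) W) g n (c n) (L (x i)))) =
      iwasawaToPowerSeries 2 ((((cyclotomicOmega 2 n).map (Int.castRingHom ℤ_[2]) : ℤ_[2][X]) : PowerSeries ℤ_[2]) * q))
    (hcop : ∀ 𝔭 : PrimeSpectrum (IwasawaAlgebra 2), 𝔭.asIdeal.height = 1 →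
      PowerSeries.C (2 : ℤ_[2]) ∉ 𝔭.asIdeal → ∃ i, A i ∉ 𝔭.asIdeal ∧
        Literature.NumberTheory.EllipticCurves.Kato2004.IsEulerSystemClassTwo W hκ I (x i) ∧ x i ≠ 0)
    (hprim : ∃ i, (J (L (x i))).2 ∉ Ideal.span {(PowerSeries.C (2 : ℤ_[2]) : IwasawaAlgebra 2)})
    (hϖ : 0 ≤ padicValRat 2 ϖ) :
    ∃ (Z : Submodule (IwasawaAlgebra 2) I.H) (G : IwasawaAlgebra 2),
      G ∈ Submodule.map (P.subtype ∘ₗ loc) Z ∧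
      iwasawaToPowerSeries 2 G = PowerSeries.C (ϖ : ℚ_[2]) * iwasawaToPowerSeries 2 Lf ∧
      (∃ s₀ : I.H, Z = Submodule.span (IwasawaAlgebra 2) {s₀} ∧
        ∀ 𝔭 : PrimeSpectrum (IwasawaAlgebra 2), 𝔭.asIdeal.height = 1 →
          PowerSeries.C (2 : ℤ_[2]) ∉ 𝔭.asIdeal →
          ∃ (M : IwasawaAlgebra 2) (s : I.H), M ∉ 𝔭.asIdeal ∧
            Literature.NumberTheory.EllipticCurves.Kato2004.IsEulerSystemClassTwo W hκ I s ∧ s ≠ 0 ∧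
            M • s₀ = s) := by
  letI := moduleOfGenerator κ (closureEmb (K := ℚ) (v.adicCompletion ℚ)) W hg
  haveI hP2 : (augIdealP 2).IsPrime := isPrime_augIdealP_holds 2
  have h22 : ((2 : ℕ) : ℤ_[2]) = (2 : ℤ_[2]) := by norm_num
  -- the `p`-generic dialect of the coprimality clause and of the congruences
  have hcop' : ∀ 𝔭 : PrimeSpectrum (IwasawaAlgebra 2), 𝔭.asIdeal.height = 1 →
      PowerSeries.C ((2 : ℕ) : ℤ_[2]) ∉ 𝔭.asIdeal → ∃ i, A i ∉ 𝔭.asIdeal := fun 𝔭 h𝔭 hm ↦ by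
    obtain ⟨i, hi, -, -⟩ := hcop 𝔭 h𝔭 (by simpa using hm)
    exact ⟨i, hi⟩
  have hE3' : ∀ (i : ι) (n : ℕ), ∃ (m : ℕ) (q : IwasawaAlgebra 2), PowerSeries.C (((2 : ℕ) : ℚ_[2]) ^ m) *
        (iwasawaToPowerSeries 2 (A i) * (((mazurTateElement f 2 n).map (algebraMap ℚ ℚ_[2]) : ℚ_[2][X]) : PowerSeries ℚ_[2]) -
          iwasawaToPowerSeries 2 (PowerSeries.C d *
            pairingSum W (localTowerPointsOfEmb κ (closureEmb (K := ℚ) (v.adicCompletion ℚ)) W) g n (c n) (L (x i)))) =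
      iwasawaToPowerSeries 2 ((((cyclotomicOmega 2 n).map (Int.castRingHom ℤ_[2]) : ℤ_[2][X]) : PowerSeries ℤ_[2]) * q) :=
    fun i n ↦ by simpa only [Nat.cast_ofNat] using hE3 i n
  have hap' : ((2 : ℕ) : ℤ) ∣ ap := by simpa using hap
  -- §1: the ERL of the family, `C d · Col♭(L x_δ) = A_δ · L♭`
  have hERL : ∀ i, PowerSeries.C d * (J (L (x i))).2 = A i * Lf := fun i ↦
    (C_mul_coleman_eq_mul_of_family' hg hap' L J hJ x A hd hcop' f hL hE3' i).1
  -- the admissible exponents `e` (all `A_δ` divisible by `C(2^e)`, `2^e ∣ d`) are bounded by `v₂(d)`; take the largest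
  let Q : ℕ → Prop := fun e ↦ (∀ i, PowerSeries.C ((2 : ℤ_[2]) ^ e) ∣ A i) ∧ (2 : ℤ_[2]) ^ e ∣ d
  have hQ0 : Q 0 := ⟨fun i ↦ by simp, by simp⟩
  have hQb : ∀ e, Q e → e ≤ d.valuation := fun e he ↦
    le_valuation_of_pow_dvd (p := 2) hd (by simpa only [h22] using he.2)
  set e := Nat.findGreatest Q d.valuation with he_def
  have heQ : Q e := Nat.findGreatest_spec (P := Q) (Nat.zero_le _) hQ0
  have hemax : ∀ e', Q e' → e' ≤ e := fun e' he' ↦ Nat.le_findGreatest (hQb e' he') he'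
  -- the rescaled family
  choose A' hA' using heQ.1
  obtain ⟨d', hd'⟩ := heQ.2
  have hd'0 : d' ≠ 0 := fun h0 ↦ hd (by rw [hd', h0, mul_zero])
  have hA'eq : ∀ i, A i = PowerSeries.C (((2 : ℕ) : ℤ_[2]) ^ e) * A' i := fun i ↦ by rw [h22]; exact hA' i
  have hdeq : d = ((2 : ℕ) : ℤ_[2]) ^ e * d' := by rw [h22]; exact hd'
  -- `hE3` and `hcop` for the rescaled family
  have hE3'' : ∀ (i : ι) (n : ℕ), ∃ (m : ℕ) (q : IwasawaAlgebra 2), PowerSeries.C ((2 : ℚ_[2]) ^ m) *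
        (iwasawaToPowerSeries 2 (A' i) * (((mazurTateElement f 2 n).map (algebraMap ℚ ℚ_[2]) : ℚ_[2][X]) : PowerSeries ℚ_[2]) -
          iwasawaToPowerSeries 2 (PowerSeries.C d' *
            pairingSum W (localTowerPointsOfEmb κ (closureEmb (K := ℚ) (v.adicCompletion ℚ)) W) g n (c n) (L (x i)))) =
      iwasawaToPowerSeries 2 ((((cyclotomicOmega 2 n).map (Int.castRingHom ℤ_[2]) : ℤ_[2][X]) : PowerSeries ℤ_[2]) * q) := by
    intro i n
    have h := levelCongruence_of_C_pow_mul (p := 2) e (hA'eq i) hdeq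
      (((mazurTateElement f 2 n).map (algebraMap ℚ ℚ_[2]) : ℚ_[2][X]) : PowerSeries ℚ_[2])
      (pairingSum W (localTowerPointsOfEmb κ (closureEmb (K := ℚ) (v.adicCompletion ℚ)) W) g n (c n) (L (x i)))
      (((cyclotomicOmega 2 n).map (Int.castRingHom ℤ_[2]) : ℤ_[2][X]) : PowerSeries ℤ_[2]) (hE3' i n)
    simpa only [Nat.cast_ofNat] using h
  have hcop'' : ∀ 𝔭 : PrimeSpectrum (IwasawaAlgebra 2), 𝔭.asIdeal.height = 1 →
      PowerSeries.C (2 : ℤ_[2]) ∉ 𝔭.asIdeal → ∃ i, A' i ∉ 𝔭.asIdeal ∧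
        Literature.NumberTheory.EllipticCurves.Kato2004.IsEulerSystemClassTwo W hκ I (x i) ∧ x i ≠ 0 := by
    intro 𝔭 h𝔭 hm
    obtain ⟨i, hi, hES, hx0⟩ := hcop 𝔭 h𝔭 hm
    exact ⟨i, not_mem_of_C_pow_mul_not_mem (hA'eq i) hi, hES, hx0⟩
  -- `h2` for the rescaled family
  have h2' : ∃ i, A' i ∉ augIdealP 2 := by
    by_contra hall
    push Not at hall
    by_cases h2d : (2 : ℤ_[2]) ∣ d'
    · -- then `e + 1` is admissible, contradicting maximality
      obtain ⟨d'', hd''⟩ := h2d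
      have hQ1 : Q (e + 1) := by
        refine ⟨fun i ↦ ?_, ⟨d'', by rw [hd', hd'', pow_succ, mul_assoc]⟩⟩
        obtain ⟨B, hB⟩ := Ideal.mem_span_singleton.mp (hall i)
        refine ⟨B, ?_⟩
        rw [hA' i, hB, h22.symm, pow_succ, map_mul, mul_assoc]
      have := hemax (e + 1) hQ1
      omega
    · -- else `d'` is a unit and the ERL puts every `Col♭(L x_δ)` in `(2)`, contradicting `hprim`
      have hU : IsUnit d' := isUnit_padicInt_of_not_dvd (p := 2) (by simpa only [h22] using h2d)
      have hCU : IsUnit (PowerSeries.C d' : IwasawaAlgebra 2) := hU.map PowerSeries.C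
      obtain ⟨i₀, hi₀⟩ := hprim
      apply hi₀
      have hERL' : PowerSeries.C d' * (J (L (x i₀))).2 = A' i₀ * Lf := by
        have hCe0 : (PowerSeries.C ((2 : ℤ_[2]) ^ e) : IwasawaAlgebra 2) ≠ 0 := by
          intro h0
          have := congrArg (PowerSeries.constantCoeff (R := ℤ_[2])) h0
          simp only [PowerSeries.constantCoeff_C, map_zero] at this
          exact pow_ne_zero _ two_ne_zero this
        apply mul_left_cancel₀ hCe0
        calc (PowerSeries.C ((2 : ℤ_[2]) ^ e) : IwasawaAlgebra 2) * (PowerSeries.C d' * (J (L (x i₀))).2)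
            = PowerSeries.C d * (J (L (x i₀))).2 := by rw [hd', map_mul, mul_assoc]
          _ = A i₀ * Lf := hERL i₀
          _ = PowerSeries.C ((2 : ℤ_[2]) ^ e) * (A' i₀ * Lf) := by rw [hA' i₀, mul_assoc]
      have hmem : PowerSeries.C d' * (J (L (x i₀))).2 ∈ augIdealP 2 := by
        rw [hERL']
        exact Ideal.mul_mem_right _ _ (hall i₀)
      have := (Ideal.unit_mul_mem_iff_mem _ hCU).mp hmem
      simpa only [augIdealP, h22] using this
  have h2'' : ∀ 𝔭 : PrimeSpectrum (IwasawaAlgebra 2), 𝔭.asIdeal.height = 1 →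
      PowerSeries.C (2 : ℤ_[2]) ∈ 𝔭.asIdeal → ∃ i, A' i ∉ 𝔭.asIdeal := (forall_heightOne_C_two_mem_iff A').2 h2'
  -- `t := ϖ·d'` and Z6
  obtain ⟨t, ht⟩ := exists_padicInt_coe_eq_mul_of_padicValRat_nonneg (p := 2) d' hϖ
  exact flatF3_package_of_levelCongruences W v hss hκ hγ hg hap I hrank L J hJ P loc hloc f ϖ Ls Lf hL hLf x A' hd'0 hE3''
    hcop'' h2'' t ht

end Habitat

end SSFlatERL

end Summit.BirchSwinnertonDyer.BirchSwinnertonDyer.Theorems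

end
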